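import Mathlib
import Summits.NavierStokesRegularity.NavierStokesRegularity.Theorems.TaoLadderRungThreeGappedFrontRobustTailStep
import Summits.NavierStokesRegularity.NavierStokesRegularity.Theorems.TaoLadderRungThreeGappedFrontRobustTailStart
import HarnessLib

/-!
# `GappedFrontRobust`, the (step) clause: THE TAIL ZONE (absolute amplitude bounds on every shell beyond
  `k₂` from the tail clauses of the certificate; helper for item stmt-NavierStokesRegularity-20423 and its
  announced restatement K_B₂ over `GapData₂` + `TailThin`)

HONEST FRAMING: a theorem about Tao-type MODEL lattice pseudo-flows (Tao 2016 §4 (4.5), (4.9)–(4.10) with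
(4.3); §6.2 Prop. 6.3 (ix)) in the cell vocabulary `TaoCascade.PseudoFlowOn`; it combines the landed
one-directional tail induction (`…TailStep.pseudoFlowOn_tail_induction`) with the tail-start bookkeeping
(`…TailStart.tail_start_energy_le`). Nothing here concerns the Navier–Stokes equations; nothing is
asserted about any table.

THE TAIL ZONE THEOREM `pseudoFlowOn_tail_zone`. Data: a pseudo-flow on `[0, τ]` (any defect constants)
with a cancelling table, `ε₀ > 0`; weights `w > 0` with (T1) `2(1+ε₀)^k w k ≤ w (k+1)` and reference
amplitudes with (T2) `4 w k |z_{i,k}| ≤ r` beyond `k₁`; a ball start `w k |S₀_{i,k} − z_{i,k}| ≤ r`; tail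
slack `B₀_{i,k} ≤ β (1+ε₀)^{2k} r²/(w k)²` beyond `k₁`; the THIN-TAIL inequality
`(1+ε₀)^{5K/2} r w(K−1) ≤ ϑ (w(K−2))²` for `K ≥ k₂` (`TailThin` at the shells `K − 2`); a base bound
`|S_{i,k₂−1}| ≤ ν(k₂−1) r / w(k₂−2)` on `[0, τ]`; and target constants `ν K ≥ 0` satisfying the scalar
CLOSING CONDITION
`√2 √((4/3) m (25/32 + β(1+ε₀)^{2K})) / (2(1+ε₀)^{K−1}) + (∑|α_{(0,0,1)}|) τ (ϑ/(1+ε₀)^{5/2}) ν(K−1)² ≤ ν K`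
for `K ≥ k₂`. Conclusion: `|S_{i,K}(u)| ≤ ν K · r / w(K−1)` for every `K ≥ k₂ − 1`, `u ∈ [0, τ]`, `i` —
absolute bounds in units of the post-step tolerance, with NO bootstrap over the infinitely many tail
shells. (With `ν` constant the closing condition reads `A₀(1+ε₀)^{−(K−1)} + A₁√β + Cτϑ'ν² ≤ ν`: small
start junk by (T1), small slack by `η`, small pumping by the thin tail.)
-/

noncomputable section

-- the sub-problem namespace `Summit.NavierStokesRegularity.NavierStokesRegularity` repeats the summit name by design (D-0017)
set_option linter.dupNamespace false

namespace Summit.NavierStokesRegularity.NavierStokesRegularity.Theorems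

open Set MeasureTheory intervalIntegral Literature.Analysis.FluidPDE Literature.Analysis.FluidPDE.TaoCascade

namespace GappedFrontRobust

variable {m : ℕ}
variable {τ ε₀ : ℝ} {α : Fin m → Fin m → Fin m → ℤ × ℤ × ℤ → ℝ} {κ₁ κ₂ : ℝ}
  {S₀ F₀ B₀ : Fin m → ℤ → ℝ} {S F : Fin m → ℤ → ℝ → ℝ}

/-- **THE TAIL ZONE.** See the module docstring. [cite: Tao2016AveragedNS, §4 Lemma 4.1 (4.5), (4.9)–(4.10) with (4.3) and §6.2 Prop. 6.3 (ix)] -/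
theorem pseudoFlowOn_tail_zone (h : PseudoFlowOn τ ε₀ α κ₁ κ₂ S₀ F₀ B₀ S F) (hτ : 0 < τ)
    (hε : 0 < ε₀) (hα : IsCancellingCoeff α) {w : ℤ → ℝ} {z : Fin m → ℤ → ℝ} {r β ϑ : ℝ}
    {k₁ k₂ : ℤ} {ν : ℤ → ℝ} (hr : 0 ≤ r) (hβ : 0 ≤ β) (hw : ∀ k, 0 < w k)
    (hT1 : ∀ k : ℤ, k₁ ≤ k → 2 * (1 + ε₀) ^ (k : ℝ) * w k ≤ w (k + 1))
    (hT2 : ∀ k : ℤ, k₁ ≤ k → ∀ i, 4 * (w k * |z i k|) ≤ r)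
    (hball : ∀ i k, w k * |S₀ i k - z i k| ≤ r)
    (hB₀ : ∀ i k, k₁ ≤ k → B₀ i k ≤ β * (1 + ε₀) ^ ((2 : ℝ) * k) * r ^ 2 / w k ^ 2)
    (hthin : ∀ K : ℤ, k₂ ≤ K →
      (1 + ε₀) ^ ((5 : ℝ) * K / 2) * r * w (K - 1) ≤ ϑ * w (K - 2) ^ 2)
    (hk₂ : k₁ + 1 ≤ k₂) (hk₂' : 2 ≤ k₂) (hν : ∀ K : ℤ, k₂ - 1 ≤ K → 0 ≤ ν K)
    (hclose : ∀ K : ℤ, k₂ ≤ K →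
      Real.sqrt 2 * Real.sqrt (4 / 3 * m * (25 / 32 + β * (1 + ε₀) ^ ((2 : ℝ) * K))) /
          (2 * (1 + ε₀) ^ ((K - 1 : ℤ) : ℝ)) +
        (∑ i₁, ∑ i₂, ∑ i₃, |α i₁ i₂ i₃ (0, 0, 1)|) * τ * (ϑ / (1 + ε₀) ^ ((5 : ℝ) / 2)) *
          ν (K - 1) ^ 2 ≤ ν K)
    (hbase : ∀ u ∈ Icc 0 τ, ∀ i, |S i (k₂ - 1) u| ≤ ν (k₂ - 1) * r / w (k₂ - 2)) :
    ∀ K : ℤ, k₂ - 1 ≤ K → ∀ u ∈ Icc 0 τ, ∀ i, |S i K u| ≤ ν K * r / w (K - 1) := by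
  have hq : 0 < 1 + ε₀ := by linarith
  have hq1 : 1 ≤ 1 + ε₀ := by linarith
  set C : ℝ := ∑ i₁ : Fin m, ∑ i₂ : Fin m, ∑ i₃ : Fin m, |α i₁ i₂ i₃ (0, 0, 1)| with hC
  have hC0 : 0 ≤ C := Finset.sum_nonneg fun _ _ => Finset.sum_nonneg fun _ _ =>
    Finset.sum_nonneg fun _ _ => abs_nonneg _
  -- start energies: F₀ ≤ ½S₀² + B₀ from (4.10) at time 0
  have hF₀ : ∀ i k, F₀ i k ≤ (1 / 2) * S₀ i k ^ 2 + B₀ i k := by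
    intro i k
    have h0 : (0 : ℝ) ∈ Icc 0 τ := ⟨le_rfl, hτ.le⟩
    have := h.defect_upper i k 0 h0
    rw [h.init_F i k, h.init_S i k, intervalIntegral.integral_same, mul_zero, add_zero] at this
    exact this
  -- the tail induction with E K := (4/3) m (25/32 + β q^{2K}) r²/w_K², P K := ν K · r / w(K-1)
  set E : ℤ → ℝ := fun K => 4 / 3 * m * ((25 / 32 + β * (1 + ε₀) ^ ((2 : ℝ) * K)) * r ^ 2 / w K ^ 2)
    with hE
  set P : ℤ → ℝ := fun K => ν K * r / w (K - 1) with hP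
  have hE0 : ∀ K : ℤ, k₂ ≤ K → 0 ≤ E K := fun K _ => by
    have := hw K; have := Real.rpow_pos_of_pos hq ((2 : ℝ) * K); positivity
  have hEsum : ∀ K : ℤ, k₂ ≤ K → ∀ L : ℕ, ∑ k ∈ Finset.range L, ∑ i, F₀ i (K + k) ≤ E K :=
    fun K hK L => tail_start_energy_le hε.le hβ hw hT1 hT2 hball hF₀ hB₀ (by linarith) (by linarith) L
  have hrec : ∀ K : ℤ, k₂ ≤ K →
      Real.sqrt 2 * (Real.sqrt (E K) + Real.sqrt 2 / 2 * (1 + ε₀) ^ ((5 : ℝ) * (K - 1 : ℤ) / 2) *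
        C * (τ * P (K - 1) ^ 2)) ≤ P K := by
    intro K hK
    have hwK := hw K
    have hwK1 := hw (K - 1)
    have hwK2 := hw (K - 2)
    have hνK1 := hν (K - 1) (by linarith)
    -- √(E K) = √a · r / w K with a := (4/3) m (25/32 + β q^{2K})
    set a : ℝ := 4 / 3 * m * (25 / 32 + β * (1 + ε₀) ^ ((2 : ℝ) * K)) with ha
    have ha0 : 0 ≤ a := by have := Real.rpow_pos_of_pos hq ((2 : ℝ) * K); positivity
    have hsqrtE : Real.sqrt (E K) = Real.sqrt a * (r / w K) := by
      have : E K = a * (r / w K) ^ 2 := by simp only [hE, ha]; field_simp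
      rw [this, Real.sqrt_mul ha0, Real.sqrt_sq (div_nonneg hr hwK.le)]
    -- (T1) at K-1: r / w K ≤ r / (2 q^{K-1} w(K-1))
    have hT := hT1 (K - 1) (by linarith)
    rw [sub_add_cancel] at hT
    have hqK1 : 0 < (1 + ε₀) ^ ((K - 1 : ℤ) : ℝ) := Real.rpow_pos_of_pos hq _
    have hrw : r / w K ≤ r / (2 * (1 + ε₀) ^ ((K - 1 : ℤ) : ℝ) * w (K - 1)) :=
      div_le_div_of_nonneg_left hr (by positivity) hT
    -- the thin tail: q^{5(K-1)/2} r / w(K-2)² ≤ ϑ / (q^{5/2} w(K-1))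
    have hΛ : (1 + ε₀) ^ ((5 : ℝ) * (K - 1 : ℤ) / 2) * r / w (K - 2) ^ 2 ≤
        ϑ / ((1 + ε₀) ^ ((5 : ℝ) / 2) * w (K - 1)) := by
      rw [div_le_div_iff₀ (pow_pos hwK2 2) (by positivity)]
      have hsplit : (1 + ε₀) ^ ((5 : ℝ) * (K - 1 : ℤ) / 2) * (1 + ε₀) ^ ((5 : ℝ) / 2) =
          (1 + ε₀) ^ ((5 : ℝ) * K / 2) := by
        rw [← Real.rpow_add hq]; push_cast; ring_nf
      calc (1 + ε₀) ^ ((5 : ℝ) * (K - 1 : ℤ) / 2) * r * ((1 + ε₀) ^ ((5 : ℝ) / 2) * w (K - 1))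
          = ((1 + ε₀) ^ ((5 : ℝ) * (K - 1 : ℤ) / 2) * (1 + ε₀) ^ ((5 : ℝ) / 2)) * r * w (K - 1) := by
            ring
        _ = (1 + ε₀) ^ ((5 : ℝ) * K / 2) * r * w (K - 1) := by rw [hsplit]
        _ ≤ ϑ * w (K - 2) ^ 2 := hthin K hK
    -- the pumping term
    have hpump : (1 + ε₀) ^ ((5 : ℝ) * (K - 1 : ℤ) / 2) * C * (τ * P (K - 1) ^ 2) ≤
        C * τ * (ϑ / (1 + ε₀) ^ ((5 : ℝ) / 2)) * ν (K - 1) ^ 2 * (r / w (K - 1)) := by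
      have hKK : K - 1 - 1 = K - 2 := by ring
      simp only [hP, hKK]
      have hrr : 0 ≤ ν (K - 1) ^ 2 * r := mul_nonneg (sq_nonneg _) hr
      calc (1 + ε₀) ^ ((5 : ℝ) * (K - 1 : ℤ) / 2) * C * (τ * (ν (K - 1) * r / w (K - 2)) ^ 2)
          = C * τ * (ν (K - 1) ^ 2 * r) *
              ((1 + ε₀) ^ ((5 : ℝ) * (K - 1 : ℤ) / 2) * r / w (K - 2) ^ 2) := by
            field_simp
        _ ≤ C * τ * (ν (K - 1) ^ 2 * r) * (ϑ / ((1 + ε₀) ^ ((5 : ℝ) / 2) * w (K - 1))) :=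
            mul_le_mul_of_nonneg_left hΛ (by positivity)
        _ = C * τ * (ϑ / (1 + ε₀) ^ ((5 : ℝ) / 2)) * ν (K - 1) ^ 2 * (r / w (K - 1)) := by
            field_simp
    -- assemble with the closing condition
    have hcl := hclose K hK
    have hrw1 : 0 ≤ r / w (K - 1) := div_nonneg hr hwK1.le
    have hs2 : 0 ≤ Real.sqrt 2 := Real.sqrt_nonneg 2
    have hsa : 0 ≤ Real.sqrt a := Real.sqrt_nonneg a
    calc Real.sqrt 2 * (Real.sqrt (E K) + Real.sqrt 2 / 2 * (1 + ε₀) ^ ((5 : ℝ) * (K - 1 : ℤ) / 2) *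
          C * (τ * P (K - 1) ^ 2))
        = Real.sqrt 2 * Real.sqrt (E K) +
            ((1 + ε₀) ^ ((5 : ℝ) * (K - 1 : ℤ) / 2) * C * (τ * P (K - 1) ^ 2)) := by
          have : Real.sqrt 2 * Real.sqrt 2 = 2 := Real.mul_self_sqrt (by norm_num)
          linear_combination ((1 + ε₀) ^ ((5 : ℝ) * (K - 1 : ℤ) / 2) * C * (τ * P (K - 1) ^ 2)) / 2 * this
      _ ≤ Real.sqrt 2 * (Real.sqrt a * (r / (2 * (1 + ε₀) ^ ((K - 1 : ℤ) : ℝ) * w (K - 1)))) +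
            C * τ * (ϑ / (1 + ε₀) ^ ((5 : ℝ) / 2)) * ν (K - 1) ^ 2 * (r / w (K - 1)) := by
          rw [hsqrtE]
          gcongr
      _ = (Real.sqrt 2 * Real.sqrt a / (2 * (1 + ε₀) ^ ((K - 1 : ℤ) : ℝ)) +
            C * τ * (ϑ / (1 + ε₀) ^ ((5 : ℝ) / 2)) * ν (K - 1) ^ 2) * (r / w (K - 1)) := by
          field_simp
      _ ≤ ν K * (r / w (K - 1)) := mul_le_mul_of_nonneg_right hcl hrw1
      _ = P K := by simp only [hP]; ring
  have hbase' : ∀ u ∈ Icc 0 τ, ∀ i, |S i (k₂ - 1) u| ≤ P (k₂ - 1) := by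
    intro u hu i
    have hKK : k₂ - 1 - 1 = k₂ - 2 := by ring
    simp only [hP, hKK]
    exact hbase u hu i
  intro K hK u hu i
  have := pseudoFlowOn_tail_induction h hτ hε hα k₂ hE0 hEsum hrec hbase' K hK u hu i
  simpa only [hP] using this

set_option maxHeartbeats 400000 in
/-- **THE TAIL ZONE, energy form** (appended by p1 g9): under the hypotheses of `pseudoFlowOn_tail_zone`,
every tail shell `K ≥ k₂` also satisfies `∑_i F_{i,K}(u) ≤ (ν K · r / w(K−1))² / 2` on `[0, τ]` — the form
consumed by the epoch-envelope clause `F ≤ env` with the tail envelope `env K ≍ r²/w(K−1)²`.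
[cite: Tao2016AveragedNS, §4 Lemma 4.1 (4.5), (4.9)–(4.10) with (4.3) and §6.2 Prop. 6.3 (ix)] -/
theorem pseudoFlowOn_tail_zone_energy (h : PseudoFlowOn τ ε₀ α κ₁ κ₂ S₀ F₀ B₀ S F) (hτ : 0 < τ)
    (hε : 0 < ε₀) (hα : IsCancellingCoeff α) {w : ℤ → ℝ} {z : Fin m → ℤ → ℝ} {r β ϑ : ℝ}
    {k₁ k₂ : ℤ} {ν : ℤ → ℝ} (hr : 0 ≤ r) (hβ : 0 ≤ β) (hw : ∀ k, 0 < w k)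
    (hT1 : ∀ k : ℤ, k₁ ≤ k → 2 * (1 + ε₀) ^ (k : ℝ) * w k ≤ w (k + 1))
    (hT2 : ∀ k : ℤ, k₁ ≤ k → ∀ i, 4 * (w k * |z i k|) ≤ r)
    (hball : ∀ i k, w k * |S₀ i k - z i k| ≤ r)
    (hB₀ : ∀ i k, k₁ ≤ k → B₀ i k ≤ β * (1 + ε₀) ^ ((2 : ℝ) * k) * r ^ 2 / w k ^ 2)
    (hthin : ∀ K : ℤ, k₂ ≤ K →
      (1 + ε₀) ^ ((5 : ℝ) * K / 2) * r * w (K - 1) ≤ ϑ * w (K - 2) ^ 2)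
    (hk₂ : k₁ + 1 ≤ k₂) (hk₂' : 2 ≤ k₂) (hν : ∀ K : ℤ, k₂ - 1 ≤ K → 0 ≤ ν K)
    (hclose : ∀ K : ℤ, k₂ ≤ K →
      Real.sqrt 2 * Real.sqrt (4 / 3 * m * (25 / 32 + β * (1 + ε₀) ^ ((2 : ℝ) * K))) /
          (2 * (1 + ε₀) ^ ((K - 1 : ℤ) : ℝ)) +
        (∑ i₁, ∑ i₂, ∑ i₃, |α i₁ i₂ i₃ (0, 0, 1)|) * τ * (ϑ / (1 + ε₀) ^ ((5 : ℝ) / 2)) *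
          ν (K - 1) ^ 2 ≤ ν K)
    (hbase : ∀ u ∈ Icc 0 τ, ∀ i, |S i (k₂ - 1) u| ≤ ν (k₂ - 1) * r / w (k₂ - 2))
    {K : ℤ} (hK : k₂ ≤ K) {u : ℝ} (hu : u ∈ Icc 0 τ) :
    ∑ i, F i K u ≤ (ν K * r / w (K - 1)) ^ 2 / 2 := by
  have hq : 0 < 1 + ε₀ := by linarith
  set C : ℝ := ∑ i₁ : Fin m, ∑ i₂ : Fin m, ∑ i₃ : Fin m, |α i₁ i₂ i₃ (0, 0, 1)| with hC
  have hC0 : 0 ≤ C := Finset.sum_nonneg fun _ _ => Finset.sum_nonneg fun _ _ =>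
    Finset.sum_nonneg fun _ _ => abs_nonneg _
  have hwK := hw K
  have hwK1 := hw (K - 1)
  have hwK2 := hw (K - 2)
  have hνK1 := hν (K - 1) (by linarith)
  -- amplitude bound on shell K-1 from the tail zone
  have hamp := pseudoFlowOn_tail_zone h hτ hε hα hr hβ hw hT1 hT2 hball hB₀ hthin hk₂ hk₂' hν hclose
    hbase (K - 1) (by linarith)
  have hKK : K - 1 - 1 = K - 2 := by ring
  rw [hKK] at hamp
  -- start energies
  have hF₀ : ∀ i k, F₀ i k ≤ (1 / 2) * S₀ i k ^ 2 + B₀ i k := by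
    intro i k
    have h0 : (0 : ℝ) ∈ Icc 0 τ := ⟨le_rfl, hτ.le⟩
    have := h.defect_upper i k 0 h0
    rw [h.init_F i k, h.init_S i k, intervalIntegral.integral_same, mul_zero, add_zero] at this
    exact this
  set a : ℝ := 4 / 3 * m * (25 / 32 + β * (1 + ε₀) ^ ((2 : ℝ) * K)) with ha
  have ha0 : 0 ≤ a := by have := Real.rpow_pos_of_pos hq ((2 : ℝ) * K); positivity
  set E₀ : ℝ := 4 / 3 * m * ((25 / 32 + β * (1 + ε₀) ^ ((2 : ℝ) * K)) * r ^ 2 / w K ^ 2) with hE₀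
  have hE₀0 : 0 ≤ E₀ := by have := Real.rpow_pos_of_pos hq ((2 : ℝ) * K); positivity
  have hEsum : ∀ L : ℕ, ∑ k ∈ Finset.range L, ∑ i, F₀ i (K + k) ≤ E₀ := fun L =>
    tail_start_energy_le hε.le hβ hw hT1 hT2 hball hF₀ hB₀ (by linarith) (by linarith) L
  -- the energy form of the one-directional step with the constant bound on shell K-1
  have hP : ContinuousOn (fun _ : ℝ => ν (K - 1) * r / w (K - 2)) (Icc 0 τ) := continuousOn_const
  have hstep := pseudoFlowOn_sqrt_shell_energy_le_tail h hτ hε hα K hE₀0 hEsum hP hamp hu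
  -- the same algebra as in the tail zone
  have hsqrtE : Real.sqrt E₀ = Real.sqrt a * (r / w K) := by
    have : E₀ = a * (r / w K) ^ 2 := by simp only [hE₀, ha]; ring
    rw [this, Real.sqrt_mul ha0, Real.sqrt_sq (div_nonneg hr hwK.le)]
  have hT := hT1 (K - 1) (by linarith)
  rw [sub_add_cancel] at hT
  have hqK1 : 0 < (1 + ε₀) ^ ((K - 1 : ℤ) : ℝ) := Real.rpow_pos_of_pos hq _
  have hrw : r / w K ≤ r / (2 * (1 + ε₀) ^ ((K - 1 : ℤ) : ℝ) * w (K - 1)) :=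
    div_le_div_of_nonneg_left hr (by positivity) hT
  have hΛ : (1 + ε₀) ^ ((5 : ℝ) * (K - 1 : ℤ) / 2) * r / w (K - 2) ^ 2 ≤
      ϑ / ((1 + ε₀) ^ ((5 : ℝ) / 2) * w (K - 1)) := by
    rw [div_le_div_iff₀ (pow_pos hwK2 2) (by positivity)]
    have hsplit : (1 + ε₀) ^ ((5 : ℝ) * (K - 1 : ℤ) / 2) * (1 + ε₀) ^ ((5 : ℝ) / 2) =
        (1 + ε₀) ^ ((5 : ℝ) * K / 2) := by
      rw [← Real.rpow_add hq]; push_cast; ring_nf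
    calc (1 + ε₀) ^ ((5 : ℝ) * (K - 1 : ℤ) / 2) * r * ((1 + ε₀) ^ ((5 : ℝ) / 2) * w (K - 1))
        = ((1 + ε₀) ^ ((5 : ℝ) * (K - 1 : ℤ) / 2) * (1 + ε₀) ^ ((5 : ℝ) / 2)) * r * w (K - 1) := by
          ring
      _ = (1 + ε₀) ^ ((5 : ℝ) * K / 2) * r * w (K - 1) := by rw [hsplit]
      _ ≤ ϑ * w (K - 2) ^ 2 := hthin K hK
  have hint : ∫ v in (0 : ℝ)..u, (fun _ : ℝ => ν (K - 1) * r / w (K - 2)) v ^ 2 ≤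
      τ * (ν (K - 1) * r / w (K - 2)) ^ 2 := by
    simp only [intervalIntegral.integral_const, sub_zero, smul_eq_mul]
    nlinarith [hu.1, hu.2, sq_nonneg (ν (K - 1) * r / w (K - 2))]
  have hpump : (1 + ε₀) ^ ((5 : ℝ) * (K - 1 : ℤ) / 2) * C * (τ * (ν (K - 1) * r / w (K - 2)) ^ 2) ≤
      C * τ * (ϑ / (1 + ε₀) ^ ((5 : ℝ) / 2)) * ν (K - 1) ^ 2 * (r / w (K - 1)) := by
    have hrr : 0 ≤ ν (K - 1) ^ 2 * r := mul_nonneg (sq_nonneg _) hr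
    calc (1 + ε₀) ^ ((5 : ℝ) * (K - 1 : ℤ) / 2) * C * (τ * (ν (K - 1) * r / w (K - 2)) ^ 2)
        = C * τ * (ν (K - 1) ^ 2 * r) *
            ((1 + ε₀) ^ ((5 : ℝ) * (K - 1 : ℤ) / 2) * r / w (K - 2) ^ 2) := by
          ring
      _ ≤ C * τ * (ν (K - 1) ^ 2 * r) * (ϑ / ((1 + ε₀) ^ ((5 : ℝ) / 2) * w (K - 1))) :=
          mul_le_mul_of_nonneg_left hΛ (by positivity)
      _ = C * τ * (ϑ / (1 + ε₀) ^ ((5 : ℝ) / 2)) * ν (K - 1) ^ 2 * (r / w (K - 1)) := by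
          ring
  have hcl := hclose K hK
  have hrw1 : 0 ≤ r / w (K - 1) := div_nonneg hr hwK1.le
  have hs2 : 0 ≤ Real.sqrt 2 := Real.sqrt_nonneg 2
  have hsa : 0 ≤ Real.sqrt a := Real.sqrt_nonneg a
  have hΛ0 : 0 ≤ (1 + ε₀) ^ ((5 : ℝ) * (K - 1 : ℤ) / 2) := (Real.rpow_pos_of_pos hq _).le
  -- √2 · √(Σ F) ≤ ν K · r / w(K-1)
  have hmain : Real.sqrt 2 * Real.sqrt (∑ i, F i K u) ≤ ν K * (r / w (K - 1)) := by
    calc Real.sqrt 2 * Real.sqrt (∑ i, F i K u)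
        ≤ Real.sqrt 2 * (Real.sqrt E₀ + Real.sqrt 2 / 2 * (1 + ε₀) ^ ((5 : ℝ) * (K - 1 : ℤ) / 2) *
            C * ∫ v in (0 : ℝ)..u, (fun _ : ℝ => ν (K - 1) * r / w (K - 2)) v ^ 2) :=
          mul_le_mul_of_nonneg_left hstep hs2
      _ ≤ Real.sqrt 2 * (Real.sqrt E₀ + Real.sqrt 2 / 2 * (1 + ε₀) ^ ((5 : ℝ) * (K - 1 : ℤ) / 2) *
            C * (τ * (ν (K - 1) * r / w (K - 2)) ^ 2)) := by gcongr
      _ = Real.sqrt 2 * Real.sqrt E₀ +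
            ((1 + ε₀) ^ ((5 : ℝ) * (K - 1 : ℤ) / 2) * C * (τ * (ν (K - 1) * r / w (K - 2)) ^ 2)) := by
          have : Real.sqrt 2 * Real.sqrt 2 = 2 := Real.mul_self_sqrt (by norm_num)
          linear_combination ((1 + ε₀) ^ ((5 : ℝ) * (K - 1 : ℤ) / 2) * C *
            (τ * (ν (K - 1) * r / w (K - 2)) ^ 2)) / 2 * this
      _ ≤ Real.sqrt 2 * (Real.sqrt a * (r / (2 * (1 + ε₀) ^ ((K - 1 : ℤ) : ℝ) * w (K - 1)))) +
            C * τ * (ϑ / (1 + ε₀) ^ ((5 : ℝ) / 2)) * ν (K - 1) ^ 2 * (r / w (K - 1)) := by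
          rw [hsqrtE]
          gcongr
      _ = (Real.sqrt 2 * Real.sqrt a / (2 * (1 + ε₀) ^ ((K - 1 : ℤ) : ℝ)) +
            C * τ * (ϑ / (1 + ε₀) ^ ((5 : ℝ) / 2)) * ν (K - 1) ^ 2) * (r / w (K - 1)) := by
          ring
      _ ≤ ν K * (r / w (K - 1)) := mul_le_mul_of_nonneg_right hcl hrw1
  -- square
  have hF0 : 0 ≤ ∑ i, F i K u := Finset.sum_nonneg fun i _ => h.nonneg_F i K u hu
  have hsq : 2 * ∑ i, F i K u ≤ (ν K * (r / w (K - 1))) ^ 2 := by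
    have h1 : 0 ≤ Real.sqrt 2 * Real.sqrt (∑ i, F i K u) := by positivity
    have h2 := pow_le_pow_left₀ h1 hmain 2
    rw [mul_pow, Real.sq_sqrt (by norm_num), Real.sq_sqrt hF0] at h2
    exact h2
  have : (ν K * (r / w (K - 1))) ^ 2 = (ν K * r / w (K - 1)) ^ 2 := by ring
  rw [this] at hsq
  linarith

end GappedFrontRobust

end Summit.NavierStokesRegularity.NavierStokesRegularity.Theorems

end
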